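import Literature.AlgebraicGeometry.ShimuraVarieties.UnitaryAuxiliaryTorusDatum
import HarnessLib

/-!
# Finiteness of the class number of the auxiliary torus `T₀` (Borel 1963, Thm. 5.1) — glue g5 of the
# `hodgecm-mathlib` cell

Topic `AlgebraicGeometry/ShimuraVarieties`, sequel of `UnitaryAuxiliaryTorusDatum` (the `ℚ`-torus
`T₀ = {t ∈ Res_{L/ℚ} 𝔾_m | t · t̄ ∈ 𝔾_{m,ℚ}}` of [Liu2021] Def. C.11, its finite-adelic points
`Aux.torusFinAdelic L ≤ 𝔸_{L,f}^×`, the diagonal `Aux.toTorusFinAdelic : T₀(ℚ) → T₀(𝔸_f)` and the class group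
`Aux.classGroup L L₀ = T₀(𝔸_f) ⧸ (T₀(ℚ) · L₀)` at an open compact level `L₀`, whose docstring says «Finiteness is a
theorem (class number of `T₀`), not stated here»).  ONE named fact (D-0014), no definition.

THE PRINT.  A. Borel, *Some finiteness properties of adele groups over number fields*, Publ. Math. IHÉS 16 (1963)
[BorelIHES1963], §5, **Theorem 5.1** (p. 19, held `paper:doi-10-1007-bf02684289` p0016 L32): «The number `c(G)` of
distinct double cosets `G_A^∞ · x · G_k` (`x ∈ G_A`) is finite.» — for every algebraic matric group `G ⊂ GL_n`
defined over a number field `k`, `G_A` its adèle group and `G_A^∞ = G_∞ × ∏_𝔭 G_{𝔬_𝔭}` (§1.2; first sentence of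
the proof: «Since a compact subset `C` of `G_A` is contained in the union of finitely many right translates of
`G_A^∞` (see 1.2), 5.1 is equivalent to the existence of a compact subset `C` of `G_A` such that `G_A = G_A^∞ · C · G_k`»).
The same theorem in A. Weil, *Adèles et groupes algébriques* (Sém. Bourbaki 186, 1959), §7 «Finiteness of the class
number», **Theorem 5**: «The set `W(α) \ G_A / G_k` is finite» (`W(α) = G_∞ × ∏_p K_p`, `K_p` the stabiliser of the
lattice `α`), English translation in [BorelEtAl2020] (held, PDF p. 164 L14–L22); Platonov–Rapinchuk, *Algebraic
Groups and Number Theory* (1994), Thm. 5.1 / §8.1 («the class number of an algebraic group is finite»).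

WHAT IS VENDORED.  `Aux.finite_classGroup_printed`: for every CM number field `L` and every open compact subgroup
`L₀ ≤ T₀(𝔸_f)`, the class group `Aux.classGroup L L₀ = T₀(𝔸_f) ⧸ (T₀(ℚ) · L₀)` is finite — Borel's Thm. 5.1 READ for
the commutative group `G = T₀ ⊂ GL_{2[L:ℚ]}` over `k = ℚ` (for commutative `G` the double cosets `G_A^∞ x G_k` are
the cosets of the subgroup `G_A^∞ · G_k`; projecting `G_A = G_A^∞ · C · G_ℚ` to the finite adèles gives
`T₀(𝔸_f) = (∏_p K_p) · C_f · T₀(ℚ)` with `C_f` compact, hence finitely many classes modulo the open subgroup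
`T₀(ℚ) · L₀` for ANY open compact `L₀` — the first sentence of Borel's proof).  WEAKER than print (one torus, base
`ℚ`); `-- TODO(general form)`: the tree has no adèle-group functor for a general linear algebraic group over a
number field in which Thm. 5.1 could be stated as printed (the unitary-group case `U(H)(L⁺)\U(H)(𝔸_{L⁺,f})/K` for
ANISOTROPIC `H` is the tree's THEOREM `UnitaryGroup.finite_shimuraIndex`, via Godement compactness; `T₀ ⊇ 𝔾_m` is
not anisotropic, so that road does not cover it).  Consumer: the instance hypothesis `[Finite (Aux.classGroup L L₀)]`
of B-plan2's finite Hecke quotient descent on the auxiliary carriers (`auxQuotientDescent_of`, skeleton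
`B1HeckeQuotientDescent.lean` v4 §6: `Δ := Aux.classGroup L L₀` must be a FINITE group for `N ⊗ ℂ = ∐_Δ M_ℂ` to be
projective and for the quotient `N/Δ`), fed by `haveI := h L L₀` for `h : Aux.finite_classGroup_printed`.
NON-VACUITY (V4).  `L = ℚ(i)`: `L⁺ = ℚ`, so `T₀ = Res_{L/ℚ} 𝔾_m` (`t t̄ = |t|² ∈ ℚ` for every `t`), and
`Aux.classGroup L L₀ = 𝔸_{L,f}^× ⧸ (L^× · L₀)` is a ray class group of `ℚ(i)`, finite (trivial for `L₀ = 𝒪̂_L^×`).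

## References
* [BorelIHES1963] A. Borel, *Some finiteness properties of adele groups over number fields*, Publ. Math. IHÉS 16
  (1963) 5–30, §5 Thm. 5.1 (p. 19).
* [BorelEtAl2020] A. Borel, R. Godement, C. L. Siegel, A. Weil, *Arithmetic groups and reduction theory* (ed. L. Ji),
  Higher Education Press 2020 — A. Weil, *Adèles and algebraic groups*, §7 Thm. 5 (PDF p. 164).
* [PlatonovRapinchuk1994] V. Platonov, A. Rapinchuk, *Algebraic Groups and Number Theory*, Academic Press 1994,
  Thm. 5.1, §8.1.
* [Liu2021] Y. Liu, *Fourier–Jacobi cycles and arithmetic relative trace formula*, App. C Def. C.11 (p. 110).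
-/

namespace Literature.AlgebraicGeometry.ShimuraVarieties.UnitaryCanonicalModel.Aux

open Literature.NumberTheory.Automorphic.Liu2021.AppendixC (C5.OpenCompactSubgroup)

/-- **Finiteness of the class number of `T₀`** (Borel 1963, Thm. 5.1: «The number `c(G)` of distinct double cosets
`G_A^∞ · x · G_k` (`x ∈ G_A`) is finite», READ for the commutative `ℚ`-group `G = T₀ = {t ∈ Res_{L/ℚ} 𝔾_m | t·t̄ ∈ 𝔾_m}`
and an arbitrary open compact level): for every CM number field `L` and every open compact subgroup
`L₀ ≤ T₀(𝔸_f) = Aux.torusFinAdelic L`, the class group `T₀(ℚ)\T₀(𝔸_f)/L₀ = Aux.classGroup L L₀` is finite.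
Weil, *Adèles et groupes algébriques* §7 Thm. 5 («the set `W(α)\G_A/G_k` is finite»); Platonov–Rapinchuk Thm. 5.1.
WEAKER than print (this torus over `ℚ` only). [cite: BorelIHES1963, §5 Thm. 5.1 (p. 19)] [cite: BorelEtAl2020, Weil «Adèles and algebraic groups» §7 Thm. 5 (PDF p. 164)] -/
def finite_classGroup_printed : Prop :=
  ∀ (L : Type) [Field L] [NumberField L] [NumberField.IsCMField L]
    (L₀ : C5.OpenCompactSubgroup ↥(torusFinAdelic L)), Finite (classGroup L L₀)

end Literature.AlgebraicGeometry.ShimuraVarieties.UnitaryCanonicalModel.Aux
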